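import Literature.NumberTheory.GaloisRepresentations.HeckeCharacterOfRayClass
import Literature.NumberTheory.GaloisRepresentations.HeckeCharacterDictionary
import Literature.NumberTheory.GaloisRepresentations.HeckeLFunctionAnalyticProofs
import Literature.NumberTheory.LFunctions.RayClassConductor
import Literature.NumberTheory.LFunctions.RayClassFunctionalEquation
import HarnessLib

/-!
# Hecke's functional equation for Hecke characters of finite order (idelic form)

Topic `NumberTheory/GaloisRepresentations`; namespace `Literature.NumberTheory.GaloisRepresentations`.
Proof file (theorems only: no definition, no named fact, no instance, no `sorry`): the **finite-order
case** of the named fact `heckeLFunction_functional_equation` of `HeckeCharacter.lean` (Tate (1950),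
Thm. 4.4.1 with §4.5; Hecke (1920); Neukirch, *Algebraic Number Theory*, VII (8.5)–(8.6)), deduced
from the tree's proved ideal-theoretic theorem

> `LFunctions.rayClassLSeries_functional_equation'` (`LFunctions/RayClassFunctionalEquation`):
> Neukirch VII (8.6) for a *primitive* ray class character `χ₀ mod 𝔣` of sign type `p` — meromorphic
> `Λ, Λ'` continuing `Λ(χ₀, s) = (|d_K| 𝔑𝔣)^{s/2} L_∞(χ₀, s) L(χ₀, s)` and `Λ(χ̄₀, s)`, with
> `Λ(1 - s) = W Λ'(s)`, `|W| = 1`,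

through the dictionary between idelic Hecke characters of finite order and ray class characters
(`HeckeCharacterDictionary`, `HeckeCharacterOfRayClass`, `RayClassConductor`). The one new ingredient is the
**exactness of the conductor**: for the primitive associate `χ₀ mod 𝔣` of the ray class character of
`χ`, the idelic character `χ` is ramified at *every* prime of `𝔣` (and unramified, with
`χ(ϖ_𝔭) = χ₀(𝔭)`, at every `𝔭 ∤ 𝔣`), so that the Euler product `heckeLFunction χ` — taken over the
idelically unramified places — is *exactly* `L(χ₀, s)` (no Euler factor is lost or gained, as an exact
functional equation with `|W| = 1` demands).

* `HeckeCharacter.not_isUnramifiedAt_heckeOfRayClass_of_isPrimitive` — **a primitive character is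
  ramified at its conductor**: for `χ₀ mod 𝔣` primitive (`LFunctions.IsPrimitive`) and `𝔭_v ∣ 𝔣`, the
  Hecke character `ω` of `χ₀` (`heckeOfRayClass`) is ramified at `v`. If `ω_v(𝒪_vˣ) = 1`, put
  `𝔣' = ⨅_{w ≠ v} 𝔭_w^{n_w} ⊋ 𝔣`; primitivity gives a totally positive `b ≡ 1 mod 𝔣'` prime to `𝔣`
  with `χ₀((b)) ≠ 1`, but the idele `y = (b) · ⟨b⟩_v⁻¹` lies in the congruence subgroup `W_𝔣`, so
  `1 = ω((b)) ω(⟨b⟩_v)⁻¹ = ω(y) = ω₀(y) = ∏_{𝔭 ∤ 𝔣} χ₀(𝔭)^{ν_𝔭(b)} = χ₀((b))` (Neukirch VII §6, p. 472: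
  the conductor is the smallest module of definition; Cassels–Fröhlich VII §4.1).
* `HeckeCharacter.exists_primitive_rayClass_of_isFiniteOrder` — for `χ` of finite order there are
  `𝔣 ≠ 0`, a primitive ray class character `χ₀ mod 𝔣` and a sign type `p` with
  `χ unramified at v ⟺ 𝔣 ∤ 𝔭_v`, and `χ(ϖ_v) = χ₀(𝔭_v)` off `𝔣` (dictionary + primitive associate +
  rigidity `ext_of_eventually_valueAtUniformizer_eq`).
* `HeckeCharacter.heckeLFunction_eq_rayClassLSeries` (and `…_inv_eq…` for `χ⁻¹ = χ̄ ↔ χ̄₀`),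
  `HeckeCharacter.rayClassGammaFactor_eq_archGammaFactor` — the three factors of `Λ(χ₀, s)` in the
  vocabulary of `HeckeCharacter.lean` (`heckeLFunction`, `archGammaFactor` with shifts `a_w = p_w` at
  real `w`, `0` at complex `w`).
* `heckeLFunction_functional_equation_of_isFiniteOrder` — **the named fact for `χ` of finite
  order**, with `A = |d_K| 𝔑(𝔣)`.

Everything is universe-polymorphic in `K`. The general unitary case of the fact (infinite-order
Größencharaktere: Tate's adelic proof) is not addressed here.

## References

* J. Neukirch, *Algebraic Number Theory* (1999), Ch. VII §6 (p. 472: conductor, primitive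
  characters), §8 Thm. (8.5), Cor. (8.6). [NeukirchANT1999]
* J. Tate, *Fourier analysis in number fields and Hecke's zeta-functions* (1950), in Cassels–Fröhlich,
  *Algebraic Number Theory* (1967), Ch. XV, Thm. 4.4.1; Ch. VII (Tate, *Global class field theory*)
  §4.1. [TateThesis1967] [CasselsFrohlichANT1967]
* E. Hecke, Math. Z. 6 (1920), 11–51. [HeckeMathZ1920]
-/

noncomputable section

open NumberField IsDedekindDomain Filter
open scoped Classical

namespace Literature.NumberTheory.GaloisRepresentations

universe u

variable {K : Type u} [Field K] [NumberField K]

namespace HeckeCharacter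

/-! ### A primitive character is ramified at its conductor -/

/-- `𝔭_w^{n_w} ∣ 𝔣` for the multiplicity `n_w = ν_w(𝔣)` (`modulusExp`; Mathlib
`Ideal.finprod_heightOneSpectrum_factorization`). [folklore] -/
theorem pow_modulusExp_dvd {𝔣 : Ideal (𝓞 K)} (h𝔣 : 𝔣 ≠ ⊥) (w : HeightOneSpectrum (𝓞 K)) :
    w.asIdeal ^ modulusExp 𝔣 w ∣ 𝔣 := by
  have h := finprod_mem_dvd w (Ideal.hasFiniteMulSupport h𝔣)
  rw [Ideal.finprod_heightOneSpectrum_factorization h𝔣] at h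
  exact h

/-- A nonzero integer prime to `𝔣` is a `v`-adic unit at the primes of `𝔣`. [folklore] -/
theorem valuation_eq_one_of_isCoprime {𝔣 : Ideal (𝓞 K)} (h𝔣 : 𝔣 ≠ ⊥) {b : 𝓞 K} (hb : b ≠ 0)
    (hcop : IsCoprime (Ideal.span {b}) 𝔣) {v : HeightOneSpectrum (𝓞 K)} (hv : 𝔣 ≤ v.asIdeal) :
    v.valuation K (b : K) = 1 := by
  rw [valuation_coe_eq_exp_neg_count v hb, count_span_eq_zero_of_isCoprime h𝔣 hb hcop hv]
  simp

/-- **A primitive ray class character is ramified at every prime of its modulus** (Neukirch VII §6,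
p. 472: the conductor `𝔣` of a primitive `χ mod 𝔣` is the smallest module of definition; idelically,
Cassels–Fröhlich VII §4.1): for `χ₀ mod 𝔣` primitive and `𝔭_v ∣ 𝔣`, the Hecke character
`ω = heckeOfRayClass` of `χ₀` is *not* unramified at `v`. If it were, take
`𝔣' = ⨅_{w ≠ v} 𝔭_w^{n_w} ⊋ 𝔣`; primitivity yields a totally positive `b ≡ 1 mod 𝔣'` prime to `𝔣` with
`χ₀((b)) ≠ 1`, while the idele `y = (b) ⟨b⟩_v⁻¹` lies in `W_𝔣`, whence
`1 = ω((b)) ω(⟨b⟩_v)⁻¹ = ω(y) = ω₀(y) = ∏_{𝔭 ∤ 𝔣} χ₀(𝔭)^{ν_𝔭(b)} = χ₀((b))`.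
[cite: NeukirchANT1999, Ch. VII §6 (p. 472)] -/
theorem not_isUnramifiedAt_heckeOfRayClass_of_isPrimitive {𝔣 : Ideal (𝓞 K)} (h𝔣 : 𝔣 ≠ ⊥)
    {χ₀ : HeightOneSpectrum (𝓞 K) → ℂ} (hχ₀ : LFunctions.IsRayClassCharacter 𝔣 χ₀)
    (hprim : LFunctions.IsPrimitive 𝔣 χ₀) {v : HeightOneSpectrum (𝓞 K)} (hv : 𝔣 ≤ v.asIdeal) :
    ¬ (heckeOfRayClass h𝔣 hχ₀).IsUnramifiedAt v := by
  intro hunr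
  set ω := heckeOfRayClass h𝔣 hχ₀ with hω
  -- the proper divisor `𝔣' = ⨅_{w ≠ v} 𝔭_w^{n_w}` of `𝔣`
  set S' : Finset (HeightOneSpectrum (𝓞 K)) := (Ideal.finite_factors h𝔣).toFinset.erase v with hS'
  have hmemS' : ∀ w, w ∈ S' ↔ w ≠ v ∧ 𝔣 ≤ w.asIdeal := fun w => by
    rw [hS', Finset.mem_erase, Set.Finite.mem_toFinset, Set.mem_setOf_eq, Ideal.dvd_iff_le]
  set 𝔣' : Ideal (𝓞 K) := S'.inf fun w => w.asIdeal ^ modulusExp 𝔣 w with h𝔣'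
  have hle : 𝔣 ≤ 𝔣' := Finset.le_inf fun w _ => Ideal.le_of_dvd (pow_modulusExp_dvd h𝔣 w)
  have hne : 𝔣' ≠ 𝔣 := by
    intro heq
    have h1 : S'.inf (fun w => w.asIdeal ^ modulusExp 𝔣 w) ≤ v.asIdeal := heq.le.trans hv
    obtain ⟨w, hwS, hw⟩ := (Ideal.IsPrime.inf_le' v.isPrime).mp h1
    have hwv : w.asIdeal ≤ v.asIdeal := Ideal.IsPrime.le_of_pow_le (hP := v.isPrime) hw
    have hweq : w = v :=
      HeightOneSpectrum.ext (w.isMaximal.eq_of_le v.isPrime.ne_top hwv)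
    exact ((hmemS' w).mp hwS).1 hweq
  -- the witness of primitivity
  obtain ⟨b, hb0, hcop, hb1, hpos, hneq⟩ := hprim.exists_ne_one 𝔣' hle hne
  have hb0' : (b : K) ≠ 0 := by exact_mod_cast hb0
  set bK : Kˣ := Units.mk0 (b : K) hb0' with hbK
  -- `b` is a `v`-adic unit
  have hbv : v.valuation K (b : K) = 1 := valuation_eq_one_of_isCoprime h𝔣 hb0 hcop hv
  have hbKv : Valued.v (algebraMap K (v.adicCompletion K) (b : K)) = 1 := by
    rw [valued_algebraMap_adicCompletion, hbv]
  have hub0 : algebraMap K (v.adicCompletion K) (b : K) ≠ 0 := fun h => by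
    rw [h, map_zero] at hbKv; exact zero_ne_one hbKv
  set ub : (v.adicCompletion K)ˣ := Units.mk0 _ hub0 with hub
  -- the idele `y = (b) ⟨b⟩_v⁻¹`
  set y : ideleGroup K := principalIdele K bK * (localUnits v ub)⁻¹ with hy
  -- `ω(y) = 1`
  have hωy : ω y = 1 := by
    rw [hy, map_mul, map_inv, ω.map_principal (principalIdele_mem bK),
      hunr.map_localUnits_eq_one ub hbKv, inv_one, mul_one]
  -- `y ∈ W_𝔣`
  have hyW : y ∈ congruenceIdeles 𝔣 := by
    refine ⟨fun w hw => ?_, fun w hw => ?_⟩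
    · rw [hy, ideleGroup_val_snd_mul, ideleGroup_val_inv_snd, principalIdele_snd]
      by_cases hwv : w = v
      · subst hwv
        simp only [localUnits_snd_apply_self, hub, hbK, Units.val_mk0]
        rw [mul_inv_cancel₀ hub0, sub_self, map_zero]
        exact zero_le
      · rw [localUnits_snd_apply_of_ne ub hwv, inv_one, mul_one]
        simp only [hbK, Units.val_mk0]
        rw [← map_one (algebraMap K (w.adicCompletion K)), ← map_sub, valued_algebraMap_adicCompletion]
        -- `b - 1 ∈ 𝔣' ≤ 𝔭_w^{n_w}`
        have hwf : 𝔣 ≤ w.asIdeal := (modulusExp_ne_zero_iff 𝔣 h𝔣 w).mp hw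
        have hmem : b - 1 ∈ w.asIdeal ^ modulusExp 𝔣 w :=
          (Finset.inf_le ((hmemS' w).mpr ⟨hwv, hwf⟩) : 𝔣' ≤ _) hb1
        have h2 : w.valuation K (((b - 1 : 𝓞 K)) : K) ≤ WithZero.exp (-(modulusExp 𝔣 w : ℤ)) := by
          rw [show (((b - 1 : 𝓞 K)) : K) = algebraMap (𝓞 K) K (b - 1) from rfl,
            HeightOneSpectrum.valuation_of_algebraMap]
          exact (HeightOneSpectrum.intValuation_le_pow_iff_mem _ _ _).mpr hmem
        simpa using h2
    · rw [hy]
      change 0 < InfinitePlace.Completion.extensionEmbeddingOfIsReal hw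
        (((principalIdele K bK : ideleGroup K) : AdeleRing (𝓞 K) K).1 w *
          (((localUnits v ub)⁻¹ : ideleGroup K) : AdeleRing (𝓞 K) K).1 w)
      rw [map_mul, ideleGroup_val_inv_fst_apply, localUnits_fst, map_inv₀]
      have h1 : InfinitePlace.Completion.extensionEmbeddingOfIsReal hw ((1 : InfiniteAdeleRing K) w) = 1 := by
        change InfinitePlace.Completion.extensionEmbeddingOfIsReal hw 1 = 1
        exact map_one _
      rw [h1, inv_one, mul_one, principalIdele_fst, InfiniteAdeleRing.algebraMap_apply]
      have e : InfinitePlace.Completion.extensionEmbeddingOfIsReal hw ((bK : K) : w.Completion) =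
          InfinitePlace.embedding_of_isReal hw (bK : K) :=
        InfinitePlace.Completion.extensionEmbeddingOfIsReal_coe hw (WithAbs.toAbs w.1 (bK : K))
      rw [e, hbK, Units.val_mk0]
      exact hpos _
  -- `ω(y) = ω₀(y) = χ₀((b))`
  have hω₀ : ω y = rayIdeleValue hχ₀ y := heckeOfRayClass_apply_of_mem h𝔣 hχ₀ hyW
  have hord : ∀ w : HeightOneSpectrum (𝓞 K), ¬ 𝔣 ≤ w.asIdeal → ideleOrd y w =
      ((Associates.mk w.asIdeal).count (Associates.mk (Ideal.span {b} : Ideal (𝓞 K))).factors : ℤ) := by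
    intro w hw
    have hwv : w ≠ v := fun h => hw (h ▸ hv)
    rw [hy, ideleOrd_mul, ideleOrd_inv, ideleOrd_localUnits_of_ne ub hwv, neg_zero, add_zero,
      ideleOrd_principalIdele, hbK, Units.val_mk0, valuation_coe_eq_exp_neg_count w hb0, WithZero.log_exp,
      neg_neg]
  have hprod : rayIdeleValue hχ₀ y = ∏ᶠ w : HeightOneSpectrum (𝓞 K), rayUnitValue hχ₀ w ^
      ((Associates.mk w.asIdeal).count (Associates.mk (Ideal.span {b} : Ideal (𝓞 K))).factors : ℤ) := by
    unfold rayIdeleValue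
    refine finprod_congr fun w => ?_
    by_cases hw : 𝔣 ≤ w.asIdeal
    · rw [rayUnitValue_of_le hχ₀ hw, one_zpow, one_zpow]
    · rw [hord w hw]
  have hval : LFunctions.idealPow K χ₀ (Ideal.span {b}) = 1 := by
    rw [← coe_finprod_rayUnitValue_pow_count h𝔣 hχ₀ hb0 hcop, ← hprod, ← hω₀, hωy, Units.val_one]
  exact hneq hval

/-! ### The primitive ray class character of a Hecke character of finite order -/

/-- **Dictionary with exact conductor.** For a Hecke character `χ` of `K` of finite order there are
a nonzero ideal `𝔣`, a *primitive* ray class character `χ₀ mod 𝔣` and a sign type `p` such that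
`χ` is unramified at `v` **iff** `𝔭_v ∤ 𝔣`, and `χ(ϖ_v) = χ₀(𝔭_v)` for `𝔭_v ∤ 𝔣`. (The ray class
character of `χ`, `exists_isRayClassCharacter_of_isFiniteOrder`, its primitive associate,
`LFunctions.exists_primitive_associate`, the Hecke character `ω` of the latter,
`heckeOfRayClass`, and `χ = ω` by rigidity `ext_of_eventually_valueAtUniformizer_eq`; the "only if"
is `not_isUnramifiedAt_heckeOfRayClass_of_isPrimitive`.) Neukirch VII (6.9), (6.13)–(6.14) and §6
p. 472. [cite: NeukirchANT1999, Ch. VII §6 (6.13)–(6.14) and p. 472] -/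
theorem exists_primitive_rayClass_of_isFiniteOrder {χ : HeckeCharacter K} (hχ : χ.IsFiniteOrder) :
    ∃ (𝔣 : Ideal (𝓞 K)) (χ₀ : HeightOneSpectrum (𝓞 K) → ℂ) (p : Finset {w : InfinitePlace K // w.IsReal}),
      𝔣 ≠ ⊥ ∧ LFunctions.IsRayClassCharacter 𝔣 χ₀ ∧ LFunctions.IsPrimitive 𝔣 χ₀ ∧
      LFunctions.IsSignType 𝔣 χ₀ p ∧
      (∀ v : HeightOneSpectrum (𝓞 K), χ.IsUnramifiedAt v ↔ ¬ 𝔣 ≤ v.asIdeal) ∧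
      ∀ v : HeightOneSpectrum (𝓞 K), ¬ 𝔣 ≤ v.asIdeal → χ.valueAtUniformizer v = χ₀ v := by
  obtain ⟨𝔪, h𝔪, hray, hur⟩ := exists_isRayClassCharacter_of_isFiniteOrder hχ
  obtain ⟨𝔣, χ₀, p, h𝔪𝔣, h𝔣, hχ₀, hprim, hp, -, hoff, -⟩ := LFunctions.exists_primitive_associate hray h𝔪
  set ω := heckeOfRayClass h𝔣 hχ₀ with hω
  -- `χ = ω`
  have hcof : ∀ᶠ v : HeightOneSpectrum (𝓞 K) in cofinite, ¬ 𝔪 ≤ v.asIdeal := by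
    rw [eventually_cofinite]
    simpa using finite_setOf_ideal_le h𝔪
  have heq : χ = ω := by
    refine ext_of_eventually_valueAtUniformizer_eq (hcof.mono fun v hv => ?_)
    have hvf : ¬ 𝔣 ≤ v.asIdeal := fun h => hv (h𝔪𝔣.trans h)
    rw [heckeOfRayClass_valueAtUniformizer h𝔣 hχ₀ hvf, hoff v hv]
  refine ⟨𝔣, χ₀, p, h𝔣, hχ₀, hprim, hp, fun v => ⟨fun h hv => ?_, fun hv => ?_⟩, fun v hv => ?_⟩
  · exact not_isUnramifiedAt_heckeOfRayClass_of_isPrimitive h𝔣 hχ₀ hprim hv (by rw [heq] at h; exact h)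
  · rw [heq]; exact heckeOfRayClass_isUnramifiedAt h𝔣 hχ₀ hv
  · rw [heq]; exact heckeOfRayClass_valueAtUniformizer h𝔣 hχ₀ hv

/-! ### The three factors of `Λ(χ₀, s)` in the vocabulary of `HeckeCharacter.lean` -/

/-- **`L(χ, s) = L(χ₀, s)` exactly** on `re s > 1`: if `χ` is unramified precisely off `𝔣` with
`χ(ϖ_v) = χ₀(𝔭_v)` there (`exists_primitive_rayClass_of_isFiniteOrder`), the idelic Euler product
`heckeLFunction χ` (over the unramified places) is the ray class `L`-series of `χ₀ mod 𝔣`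
(`LFunctions.rayClassLSeries_eq_tprod`, Neukirch VII (8.1)/(8.2)). [cite: NeukirchANT1999, Ch. VII §8 (8.2)] -/
theorem heckeLFunction_eq_rayClassLSeries {χ : HeckeCharacter K} {𝔣 : Ideal (𝓞 K)} (h𝔣 : 𝔣 ≠ ⊥)
    {χ₀ : HeightOneSpectrum (𝓞 K) → ℂ} (hχ₀ : LFunctions.IsRayClassCharacter 𝔣 χ₀)
    (hiff : ∀ v : HeightOneSpectrum (𝓞 K), χ.IsUnramifiedAt v ↔ ¬ 𝔣 ≤ v.asIdeal)
    (hval : ∀ v : HeightOneSpectrum (𝓞 K), ¬ 𝔣 ≤ v.asIdeal → χ.valueAtUniformizer v = χ₀ v)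
    {s : ℂ} (hs : 1 < s.re) :
    heckeLFunction χ s = LFunctions.rayClassLSeries 𝔣 χ₀ s := by
  rw [LFunctions.rayClassLSeries_eq_tprod h𝔣 (fun v hv => (hχ₀.norm_eq_one v hv).le) hs, heckeLFunction]
  let e : {v : HeightOneSpectrum (𝓞 K) // χ.IsUnramifiedAt v} ≃
      {v : HeightOneSpectrum (𝓞 K) // ¬ 𝔣 ≤ v.asIdeal} := Equiv.subtypeEquivRight fun v => hiff v
  rw [← Equiv.tprod_eq e]
  refine tprod_congr fun v => ?_
  have hv : ¬ 𝔣 ≤ (v.1).asIdeal := (hiff v.1).mp v.2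
  change (1 - χ.valueAtUniformizer v.1 * ((v.1.residueCard : ℂ) ^ (-s)))⁻¹ =
    (1 - χ₀ v.1 * ((Ideal.absNorm v.1.asIdeal : ℕ) : ℂ) ^ (-s))⁻¹
  rw [hval v.1 hv]
  rfl

/-- **`L(χ̄, s) = L(χ̄₀, s)` exactly** on `re s > 1`, for `χ` unitary (`χ⁻¹ = χ̄`:
`valueAtUniformizer_inv_of_isUnitary`, `isUnramifiedAt_inv_iff`). [cite: NeukirchANT1999, Ch. VII §8 (8.2)] -/
theorem heckeLFunction_inv_eq_rayClassLSeries_star {χ : HeckeCharacter K} (hunit : χ.IsUnitary)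
    {𝔣 : Ideal (𝓞 K)} (h𝔣 : 𝔣 ≠ ⊥)
    {χ₀ : HeightOneSpectrum (𝓞 K) → ℂ} (hχ₀ : LFunctions.IsRayClassCharacter 𝔣 χ₀)
    (hiff : ∀ v : HeightOneSpectrum (𝓞 K), χ.IsUnramifiedAt v ↔ ¬ 𝔣 ≤ v.asIdeal)
    (hval : ∀ v : HeightOneSpectrum (𝓞 K), ¬ 𝔣 ≤ v.asIdeal → χ.valueAtUniformizer v = χ₀ v)
    {s : ℂ} (hs : 1 < s.re) :
    heckeLFunction χ⁻¹ s = LFunctions.rayClassLSeries 𝔣 (star χ₀) s := by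
  rw [LFunctions.rayClassLSeries_eq_tprod h𝔣 (fun v hv => ?_) hs, heckeLFunction]
  · let e : {v : HeightOneSpectrum (𝓞 K) // χ⁻¹.IsUnramifiedAt v} ≃
        {v : HeightOneSpectrum (𝓞 K) // ¬ 𝔣 ≤ v.asIdeal} :=
      Equiv.subtypeEquivRight fun v => isUnramifiedAt_inv_iff.trans (hiff v)
    rw [← Equiv.tprod_eq e]
    refine tprod_congr fun v => ?_
    have hv : ¬ 𝔣 ≤ (v.1).asIdeal := (hiff v.1).mp (isUnramifiedAt_inv_iff.mp v.2)
    change (1 - χ⁻¹.valueAtUniformizer v.1 * ((v.1.residueCard : ℂ) ^ (-s)))⁻¹ =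
      (1 - (star χ₀) v.1 * ((Ideal.absNorm v.1.asIdeal : ℕ) : ℂ) ^ (-s))⁻¹
    rw [valueAtUniformizer_inv_of_isUnitary hunit, hval v.1 hv]
    rfl
  · rw [Pi.star_apply, norm_star]
    exact (hχ₀.norm_eq_one v hv).le

/-- **`L_∞(χ₀, s) = γ_a(s)`**: the `Γ`-factor `∏_{w real} Γ_ℝ(s + p_w) ∏_{w complex} Γ_ℂ(s)` of a ray
class character of sign type `p` (`LFunctions.rayClassGammaFactor`, Neukirch VII (8.3)–(8.4)) is the
`Γ`-factor `HeckeCharacter.archGammaFactor a` of `HeckeCharacter.lean` with shifts `a_w = p_w`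
(`= 2 · halfWeight`) at the real places and `a_w = 0` at the complex places. [cite: NeukirchANT1999, Ch. VII §8 (8.3)] -/
theorem rayClassGammaFactor_eq_archGammaFactor (p : Finset {w : InfinitePlace K // w.IsReal}) (s : ℂ) :
    LFunctions.rayClassGammaFactor K p s =
      HeckeCharacter.archGammaFactor
        (fun w : InfinitePlace K => if w.IsReal then 2 * (LFunctions.NumberField.halfWeight K p w : ℂ) else 0) s := by
  unfold LFunctions.rayClassGammaFactor HeckeCharacter.archGammaFactor
  rw [← Fintype.prod_subtype_mul_prod_subtype (fun w : InfinitePlace K => w.IsReal)]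
  congr 1
  · refine Fintype.prod_congr _ _ fun w => ?_
    simp only [if_pos w.2]
  · let e : {w : InfinitePlace K // w.IsComplex} ≃ {w : InfinitePlace K // ¬ w.IsReal} :=
      Equiv.subtypeEquivRight fun w => InfinitePlace.not_isReal_iff_isComplex.symm
    rw [← Fintype.prod_equiv e (fun w => Complex.Gammaℂ s)
      (fun w => if w.1.IsReal then Complex.Gammaℝ (s + if w.1.IsReal then 2 * (LFunctions.NumberField.halfWeight K p w.1 : ℂ) else 0)
        else Complex.Gammaℂ (s + if w.1.IsReal then 2 * (LFunctions.NumberField.halfWeight K p w.1 : ℂ) else 0)) fun w => ?_]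
    have hw : ¬ (e w).1.IsReal := (e w).2
    simp only [if_neg hw, add_zero]

end HeckeCharacter

/-! ### The named fact for characters of finite order -/

/-- **Hecke's functional equation for Hecke characters of finite order** — the named fact
`heckeLFunction_functional_equation χ` of `HeckeCharacter.lean` (Tate (1950), Thm. 4.4.1; Hecke
(1920); Neukirch VII (8.5)–(8.6)) for `χ` of finite order: with the primitive ray class character
`χ₀ mod 𝔣` of sign type `p` attached to `χ` (`HeckeCharacter.exists_primitive_rayClass_of_isFiniteOrder`),
`A = |d_K| 𝔑(𝔣)`, `a = a' = (p_w)_w`, and `W`, `Λ`, `Λ'` from Neukirch VII (8.6)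
(`LFunctions.rayClassLSeries_functional_equation'`): `Λ(s) = A^{s/2} γ_a(s) L(χ, s)`,
`Λ'(s) = A^{s/2} γ_a(s) L(χ̄, s)` on `re s > 1`, `Λ(1 - s) = W Λ'(s)`, `|W| = 1`.
[cite: NeukirchANT1999, Ch. VII §8 Cor. (8.6)] [cite: TateThesis1967, Thm. 4.4.1] -/
theorem heckeLFunction_functional_equation_of_isFiniteOrder {χ : HeckeCharacter K} (hχ : χ.IsFiniteOrder) :
    heckeLFunction_functional_equation χ := by
  intro hunit
  obtain ⟨𝔣, χ₀, p, h𝔣, hχ₀, hprim, hp, hiff, hval⟩ := HeckeCharacter.exists_primitive_rayClass_of_isFiniteOrder hχ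
  obtain ⟨W, Λ, Λ', hW, hmΛ, hmΛ', -, -, hΛ, hΛ', hFE⟩ :=
    LFunctions.rayClassLSeries_functional_equation' hχ₀ hprim hp h𝔣
  set a : InfinitePlace K → ℂ := fun w => if w.IsReal then 2 * (LFunctions.NumberField.halfWeight K p w : ℂ) else 0 with ha
  have hA : (0 : ℝ) < |(discr K : ℝ)| * (Ideal.absNorm 𝔣 : ℝ) := by
    refine mul_pos (abs_pos.mpr (by exact_mod_cast discr_ne_zero K)) ?_
    exact_mod_cast Nat.pos_of_ne_zero (Ideal.absNorm_eq_zero_iff.not.mpr h𝔣)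
  refine ⟨|(discr K : ℝ)| * (Ideal.absNorm 𝔣 : ℝ), a, a, W, Λ, Λ', hA, hW, hmΛ, hmΛ', fun s hs => ⟨?_, ?_⟩, hFE⟩
  · rw [hΛ s hs, LFunctions.completedRayClassL, HeckeCharacter.rayClassGammaFactor_eq_archGammaFactor,
      HeckeCharacter.heckeLFunction_eq_rayClassLSeries h𝔣 hχ₀ hiff hval hs]
  · rw [hΛ' s hs, LFunctions.completedRayClassL, HeckeCharacter.rayClassGammaFactor_eq_archGammaFactor,
      HeckeCharacter.heckeLFunction_inv_eq_rayClassLSeries_star hunit h𝔣 hχ₀ hiff hval hs]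

end Literature.NumberTheory.GaloisRepresentations
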